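import Literature.MathematicalPhysics.QuantumFieldTheory.Balaban1983to89.Beta.KKTFluctuationEnergy

/-!
# `BalabanUV.Beta.D1BFx.LamFactor` — road «BF-x», binder row D1, slot (K), row **(K8-L)(d) CENSUS, group G_Λ, identity (II)**: the
# FACTORISATION of the block-averaged moments of a `Λ′ ⊗ X` word — `M₀ = 0`, `M₂^{αβ} = N^{−(d+1)}·Σ_μ q^Λ_{αβ}(μ)·N̄_X(μ)`
# (an3-g51 LETTER «Λ-NULL» §2 (II); owner d1-p2-g9 CLAIM + STATEMENT «LAM-FACTOR», taken «MINE instead» by this leaf seat)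

HONEST DEPENDENCY (cell records, verbatim): «continuum YM on T⁴ ⇐ BetaPertH ∧ nine spine estimates (0/9 proved); BetaPertH ⇐ (D1) ∧ (D4) ∧
CAP+tail; G-an2-4 gates asym, D1 and NE2/3/4.»  HONEST FRAMING (cell contract, verbatim): «discharging `BetaPertH` makes Bałaban's UV stability
UNCONDITIONAL — a real constructive-QFT result; it is NOT the continuum limit and NOT the Clay problem.»  THIS MODULE DISCHARGES NOTHING of (K),
of D1 or of the wall: [folklore] dominated Fubini ∕ Euclidean block regrouping over ABSTRACT data `Λ Nr : Fin (d+1) → ℤ^{d+1} → ℤ^{d+1} → ℝ`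
(read `Λ μ y u = Λ′_{(μ,y)}[e_u]`, `Nr μ y u′ = N_X((μ,y),u′)`; word `W u u′ = Σ_μ Σ'_y Λ μ y u·Nr μ y u′`), using the tree's
`KKTFluctuationEnergy.tsum_blocks` BY NAME.  No definition, no `def … : Prop`, nothing cited, 0 sorry.  The road instance (`lamCoeffOf`,
`lamCoeffOf_translate`, `abs_lamCoeffOf_le`, nulls `LamCoeffAffineNull`) and the letter's (III) (hW-class BINDER content) are NOT here.
HYPOTHESES: block COVARIANCE `Λ μ (y+t) (u + N•t) = Λ μ y u`, `Nr μ (y+t) (u′ + N•t) = Nr μ y u′`; §1–§2 absolute summability DISPLAYED, §3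
DISCHARGED from the decay `|Λ μ y u| ≤ C e^{−δ|N•y − u|₁}`, `|Nr μ y u′| ≤ C′ e^{−δ′|N•y − u′|₁}`; NULLS `Σ'_u Λ μ 0 u = 0`, `Σ'_u u_γ Λ μ 0 u = 0`.
* §1 [folklore] **`blockSum_weight_eq`** (any weight `p`): `Σ_{b∈box} Σ'_{u′} p(u′−b)·W b u′ = Σ_μ Σ'_w Σ'_{u″} p(u″−w)·Λ μ 0 w·Nr μ 0 u″`
  (Fubini, covariance to `y = 0`, shift `u′ ↦ u′ − N•y`, block regrouping `box × ℤ^{d+1} ≃ ℤ^{d+1}`).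
* §2 [folklore] **`blockAvg_M0_eq_zero`**, **`blockAvg_M2_eq`** (`qLam α β μ = Σ'_w w_α w_β Λ μ 0 w`, `Nbar μ = Σ'_{u′} Nr μ 0 u′`;
  expansion of `(u″−w)_α(u″−w)_β`, three of four terms killed by the nulls).
* §3 [folklore] `summable_word_of_decay` ∕ `summable_level0_of_decay` ∕ `summable_moment_of_decay` and the DECAY-FORM statements
  **`blockAvg_M0_eq_zero_of_decay`**, **`blockAvg_M2_eq_of_decay`** (the owner's statement line verbatim).
NOT D1, NOT BetaPertH, NOT continuum, NOT Clay.  ABSOLUTE RULE (cell charter, verbatim): «No internally-minted statement may enter as a cited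
fact. Every hypothesis is either kernel-proved in this package or a verbatim quotation of a PUBLISHED theorem with page reference. The manuscript(s)
under audit are NOT citable for their own disputed steps — they are the thing under adjudication; programme-internal (2001/route/tribunal) claims are
never citable.»  Provenance: D1 formalisation swarm leaf seat `b2b-balaban-beta-d1-formalise-leaf-04` gen 8, 2026-08-21.
-/

noncomputable section

namespace Summit.QuantumFields.BalabanUV.Beta.D1BFx.LamFactor

open Finset
open scoped BigOperators
open Literature.MathematicalPhysics.QuantumFieldTheory.Balaban1983to89
open Literature.MathematicalPhysics.QuantumFieldTheory.Balaban1983to89.Beta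
open B12Sec2to5 (l1 l1_nonneg abs_coord_le_l1 summable_exp_neg_l1)
open AffineAveraging (Site box toSite)
open KKTFluctuationEnergy (tsum_blocks)

variable {d : ℕ}

/-! ## §1 The regrouping core -/

section Core

variable (N : ℕ) [NeZero N] (Λ Nr : Fin (d + 1) → Site (d + 1) → Site (d + 1) → ℝ) (p : Site (d + 1) → ℝ)

omit [NeZero N] in
/-- [folklore] COVARIANCE TO LEVEL `y = 0`: `Λ μ y u = Λ μ 0 (u − N•y)`. -/
theorem cov_zero {Λ : Fin (d + 1) → Site (d + 1) → Site (d + 1) → ℝ}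
    (hcov : ∀ μ y t u, Λ μ (y + t) (u + (N : ℤ) • t) = Λ μ y u) (μ : Fin (d + 1)) (y u : Site (d + 1)) :
    Λ μ y u = Λ μ 0 (u - (N : ℤ) • y) := by
  have h := hcov μ 0 y (u - (N : ℤ) • y)
  rw [zero_add, sub_add_cancel] at h
  exact h

/-- [folklore] **THE REGROUPING CORE** (any weight `p`; covariance + displayed summability). -/
theorem blockSum_weight_eq
    (hcovΛ : ∀ μ y t u, Λ μ (y + t) (u + (N : ℤ) • t) = Λ μ y u)
    (hcovN : ∀ μ y t u', Nr μ (y + t) (u' + (N : ℤ) • t) = Nr μ y u')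
    (hS1 : ∀ (μ : Fin (d + 1)) (u : Site (d + 1)),
      Summable (Function.uncurry fun (y : Site (d + 1)) (u' : Site (d + 1)) => p (u' - u) * (Λ μ y u * Nr μ y u')))
    (hS2 : ∀ μ : Fin (d + 1),
      Summable (Function.uncurry fun (w : Site (d + 1)) (u'' : Site (d + 1)) => p (u'' - w) * (Λ μ 0 w * Nr μ 0 u''))) :
    ∑ b ∈ box (d + 1) N, ∑' u', p (u' - toSite b) * (∑ μ, ∑' y, Λ μ y (toSite b) * Nr μ y u')
      = ∑ μ, ∑' w, ∑' u'', p (u'' - w) * (Λ μ 0 w * Nr μ 0 u'') := by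
  classical
  have hN0 : (N : ℤ) ≠ 0 := by exact_mod_cast (NeZero.ne N)
  set G : Fin (d + 1) → Site (d + 1) → ℝ := fun μ w => ∑' u'', p (u'' - w) * (Λ μ 0 w * Nr μ 0 u'') with hG
  have hGs : ∀ μ, Summable (G μ) := fun μ => (hS2 μ).prod
  have step1 : ∀ u : Site (d + 1), ∑' u', p (u' - u) * (∑ μ, ∑' y, Λ μ y u * Nr μ y u')
      = ∑ μ, ∑' y, ∑' u', p (u' - u) * (Λ μ y u * Nr μ y u') := by
    intro u
    have e1 : ∀ u', p (u' - u) * (∑ μ, ∑' y, Λ μ y u * Nr μ y u') = ∑ μ, ∑' y, p (u' - u) * (Λ μ y u * Nr μ y u') := by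
      intro u'
      rw [Finset.mul_sum]
      refine Finset.sum_congr rfl fun μ _ => ?_
      rw [← tsum_mul_left]
    simp_rw [e1]
    have hsum : ∀ μ, Summable fun u' => ∑' y, p (u' - u) * (Λ μ y u * Nr μ y u') := fun μ => (hS1 μ u).prod_symm.prod
    rw [Summable.tsum_finsetSum (fun μ _ => hsum μ)]
    refine Finset.sum_congr rfl fun μ _ => ?_
    exact (hS1 μ u).tsum_comm
  have step2 : ∀ (μ : Fin (d + 1)) (u y : Site (d + 1)),
      ∑' u', p (u' - u) * (Λ μ y u * Nr μ y u') = G μ (u - (N : ℤ) • y) := by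
    intro μ u y
    rw [hG]
    simp only
    rw [← (Equiv.addRight ((N : ℤ) • y)).tsum_eq (fun u' => p (u' - u) * (Λ μ y u * Nr μ y u'))]
    refine tsum_congr fun u'' => ?_
    simp only [Equiv.coe_addRight]
    rw [cov_zero N hcovΛ μ y u, cov_zero N hcovN μ y (u'' + (N : ℤ) • y), add_sub_cancel_right]
    congr 2
    abel
  have step3 : ∀ μ : Fin (d + 1), ∑ b ∈ box (d + 1) N, ∑' y, G μ (toSite b - (N : ℤ) • y) = ∑' w, G μ w := by
    intro μ
    have hinj : ∀ b : Fin (d + 1) → ℕ, Function.Injective fun y : Site (d + 1) => (N : ℤ) • y + toSite b := by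
      intro b y₁ y₂ h
      have h' : (N : ℤ) • y₁ = (N : ℤ) • y₂ := add_right_cancel h
      exact smul_right_injective _ hN0 h'
    have e : ∀ b ∈ box (d + 1) N, ∑' y, G μ (toSite b - (N : ℤ) • y) = ∑' y, G μ ((N : ℤ) • y + toSite b) := by
      intro b _
      rw [← (Equiv.neg (Site (d + 1))).tsum_eq (fun y => G μ ((N : ℤ) • y + toSite b))]
      refine tsum_congr fun y => ?_
      simp only [Equiv.neg_apply, smul_neg]
      congr 1
      abel
    have hs : ∀ b ∈ box (d + 1) N, Summable fun y : Site (d + 1) => G μ ((N : ℤ) • y + toSite b) :=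
      fun b _ => (hGs μ).comp_injective (hinj b)
    rw [Finset.sum_congr rfl e, ← Summable.tsum_finsetSum hs]
    exact (tsum_blocks (N := N) (hGs μ)).symm
  calc ∑ b ∈ box (d + 1) N, ∑' u', p (u' - toSite b) * (∑ μ, ∑' y, Λ μ y (toSite b) * Nr μ y u')
      = ∑ b ∈ box (d + 1) N, ∑ μ, ∑' y, G μ (toSite b - (N : ℤ) • y) := by
        refine Finset.sum_congr rfl fun b _ => ?_
        rw [step1]
        refine Finset.sum_congr rfl fun μ _ => tsum_congr fun y => ?_
        exact step2 μ (toSite b) y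
    _ = ∑ μ, ∑ b ∈ box (d + 1) N, ∑' y, G μ (toSite b - (N : ℤ) • y) := Finset.sum_comm
    _ = ∑ μ, ∑' w, G μ w := Finset.sum_congr rfl fun μ _ => step3 μ

end Core

/-! ## §2 The block-averaged zeroth and second moments -/

section Moments

variable (N : ℕ) [NeZero N] (Λ Nr : Fin (d + 1) → Site (d + 1) → Site (d + 1) → ℝ)

/-- [folklore] **`M₀ = 0`** (covariance + displayed summability + the monopole null). -/
theorem blockAvg_M0_eq_zero
    (hcovΛ : ∀ μ y t u, Λ μ (y + t) (u + (N : ℤ) • t) = Λ μ y u)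
    (hcovN : ∀ μ y t u', Nr μ (y + t) (u' + (N : ℤ) • t) = Nr μ y u')
    (hS1 : ∀ (μ : Fin (d + 1)) (u : Site (d + 1)),
      Summable (Function.uncurry fun (y : Site (d + 1)) (u' : Site (d + 1)) => Λ μ y u * Nr μ y u'))
    (hS2 : ∀ μ : Fin (d + 1), Summable (Function.uncurry fun (w : Site (d + 1)) (u'' : Site (d + 1)) => Λ μ 0 w * Nr μ 0 u''))
    (h0 : ∀ μ : Fin (d + 1), ∑' u, Λ μ 0 u = 0) :
    ((N : ℝ) ^ (d + 1))⁻¹ * ∑ b ∈ box (d + 1) N, ∑' u', (∑ μ, ∑' y, Λ μ y (toSite b) * Nr μ y u') = 0 := by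
  have hS1' : ∀ (μ : Fin (d + 1)) (u : Site (d + 1)), Summable (Function.uncurry fun (y : Site (d + 1)) (u' : Site (d + 1)) =>
      (fun _ : Site (d + 1) => (1 : ℝ)) (u' - u) * (Λ μ y u * Nr μ y u')) := fun μ u => by
    simpa only [one_mul] using hS1 μ u
  have hS2' : ∀ μ : Fin (d + 1), Summable (Function.uncurry fun (w : Site (d + 1)) (u'' : Site (d + 1)) =>
      (fun _ : Site (d + 1) => (1 : ℝ)) (u'' - w) * (Λ μ 0 w * Nr μ 0 u'')) := fun μ => by
    simpa only [one_mul] using hS2 μ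
  have h := blockSum_weight_eq N Λ Nr (fun _ => (1 : ℝ)) hcovΛ hcovN hS1' hS2'
  simp only [one_mul] at h
  rw [h]
  have hz : ∀ μ : Fin (d + 1), ∑' (w : Site (d + 1)) (u'' : Site (d + 1)), Λ μ 0 w * Nr μ 0 u'' = 0 := by
    intro μ
    simp_rw [tsum_mul_left]
    rw [tsum_mul_right, h0 μ, zero_mul]
  simp only [hz, Finset.sum_const_zero, mul_zero]

/-- [folklore] **`M₂^{αβ} = N^{−(d+1)}·Σ_μ qLam α β μ · Nbar μ`** (covariance + displayed summability + monopole∕dipole nulls). -/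
theorem blockAvg_M2_eq (α β : Fin (d + 1))
    (hcovΛ : ∀ μ y t u, Λ μ (y + t) (u + (N : ℤ) • t) = Λ μ y u)
    (hcovN : ∀ μ y t u', Nr μ (y + t) (u' + (N : ℤ) • t) = Nr μ y u')
    (hS1 : ∀ (μ : Fin (d + 1)) (u : Site (d + 1)), Summable (Function.uncurry fun (y : Site (d + 1)) (u' : Site (d + 1)) =>
      ((((u' - u) α : ℤ) : ℝ) * (((u' - u) β : ℤ) : ℝ)) * (Λ μ y u * Nr μ y u')))
    (hS2 : ∀ μ : Fin (d + 1), Summable (Function.uncurry fun (w : Site (d + 1)) (u'' : Site (d + 1)) =>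
      ((((u'' - w) α : ℤ) : ℝ) * (((u'' - w) β : ℤ) : ℝ)) * (Λ μ 0 w * Nr μ 0 u'')))
    (hΛ0 : ∀ μ : Fin (d + 1), Summable (Λ μ 0)) (hΛ1 : ∀ μ γ : Fin (d + 1), Summable fun w : Site (d + 1) => ((w γ : ℤ) : ℝ) * Λ μ 0 w)
    (hΛ2 : ∀ μ : Fin (d + 1), Summable fun w : Site (d + 1) => ((w α : ℤ) : ℝ) * ((w β : ℤ) : ℝ) * Λ μ 0 w)
    (h0 : ∀ μ : Fin (d + 1), ∑' u, Λ μ 0 u = 0) (h1 : ∀ μ γ : Fin (d + 1), ∑' u : Site (d + 1), ((u γ : ℤ) : ℝ) * Λ μ 0 u = 0) :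
    ((N : ℝ) ^ (d + 1))⁻¹ * ∑ b ∈ box (d + 1) N, ∑' u', ((((u' - toSite b) α : ℤ) : ℝ) * (((u' - toSite b) β : ℤ) : ℝ))
        * (∑ μ, ∑' y, Λ μ y (toSite b) * Nr μ y u')
      = ((N : ℝ) ^ (d + 1))⁻¹ * ∑ μ, (∑' w : Site (d + 1), ((w α : ℤ) : ℝ) * ((w β : ℤ) : ℝ) * Λ μ 0 w) * (∑' u', Nr μ 0 u') := by
  have h := blockSum_weight_eq N Λ Nr (fun z : Site (d + 1) => ((z α : ℤ) : ℝ) * ((z β : ℤ) : ℝ)) hcovΛ hcovN hS1 hS2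
  rw [h]
  congr 1
  refine Finset.sum_congr rfl fun μ _ => ?_
  rw [← (hS2 μ).tsum_comm]
  have inner : ∀ u'' : Site (d + 1),
      ∑' w : Site (d + 1), ((((u'' - w) α : ℤ) : ℝ) * (((u'' - w) β : ℤ) : ℝ)) * (Λ μ 0 w * Nr μ 0 u'')
        = (∑' w : Site (d + 1), ((w α : ℤ) : ℝ) * ((w β : ℤ) : ℝ) * Λ μ 0 w) * Nr μ 0 u'' := by
    intro u''
    have e : (fun w : Site (d + 1) => ((((u'' - w) α : ℤ) : ℝ) * (((u'' - w) β : ℤ) : ℝ)) * (Λ μ 0 w * Nr μ 0 u''))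
        = fun w => ((((u'' α : ℤ) : ℝ) * ((u'' β : ℤ) : ℝ) * Λ μ 0 w - ((u'' α : ℤ) : ℝ) * (((w β : ℤ) : ℝ) * Λ μ 0 w))
            - ((u'' β : ℤ) : ℝ) * (((w α : ℤ) : ℝ) * Λ μ 0 w) + ((w α : ℤ) : ℝ) * ((w β : ℤ) : ℝ) * Λ μ 0 w) * Nr μ 0 u'' := by
      funext w
      simp only [Pi.sub_apply, Int.cast_sub]
      ring
    rw [e, tsum_mul_right]
    congr 1
    have sA : Summable fun w : Site (d + 1) => ((u'' α : ℤ) : ℝ) * ((u'' β : ℤ) : ℝ) * Λ μ 0 w := (hΛ0 μ).mul_left _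
    have sB : Summable fun w : Site (d + 1) => ((u'' α : ℤ) : ℝ) * (((w β : ℤ) : ℝ) * Λ μ 0 w) := (hΛ1 μ β).mul_left _
    have sC : Summable fun w : Site (d + 1) => ((u'' β : ℤ) : ℝ) * (((w α : ℤ) : ℝ) * Λ μ 0 w) := (hΛ1 μ α).mul_left _
    rw [(((sA.sub sB).sub sC).tsum_add (hΛ2 μ)), ((sA.sub sB).tsum_sub sC), (sA.tsum_sub sB), tsum_mul_left, tsum_mul_left,
      tsum_mul_left, h0 μ, h1 μ β, h1 μ α]
    ring
  simp_rw [inner]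
  rw [tsum_mul_left]

end Moments

/-! ## §3 The `Summable` companions from exponential decay, and the decay-form statements -/

section Decay

/-- [folklore] `|x + y|₁ ≤ |x|₁ + |y|₁`. -/
theorem l1_add_le {D : ℕ} (x y : Site D) : l1 (x + y) ≤ l1 x + l1 y := by
  unfold B12Sec2to5.l1
  rw [← Finset.sum_add_distrib]
  refine Finset.sum_le_sum fun i _ => ?_
  rw [show (((x + y) i : ℤ) : ℝ) = ((x i : ℤ) : ℝ) + ((y i : ℤ) : ℝ) by push_cast [Pi.add_apply]; ring]
  exact abs_add_le _ _

/-- [folklore] `|−x|₁ = |x|₁`. -/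
theorem l1_neg {D : ℕ} (x : Site D) : l1 (-x) = l1 x := by
  unfold B12Sec2to5.l1
  refine Finset.sum_congr rfl fun i _ => ?_
  rw [show (((-x) i : ℤ) : ℝ) = -((x i : ℤ) : ℝ) by push_cast [Pi.neg_apply]; ring, abs_neg]

/-- [folklore] `(1 + (a + b))² ≤ (1 + a)²·(1 + b)²` for `a, b ≥ 0`. -/
theorem one_add_add_sq_le {a b : ℝ} (ha : 0 ≤ a) (hb : 0 ≤ b) : (1 + (a + b)) ^ 2 ≤ (1 + a) ^ 2 * (1 + b) ^ 2 := by
  have h : 1 + (a + b) ≤ (1 + a) * (1 + b) := by nlinarith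
  have h0 : 0 ≤ 1 + (a + b) := by positivity
  calc (1 + (a + b)) ^ 2 ≤ ((1 + a) * (1 + b)) ^ 2 := pow_le_pow_left₀ h0 h 2
    _ = (1 + a) ^ 2 * (1 + b) ^ 2 := by ring

/-- [folklore] The polynomially weighted lattice exponential `(1 + |x|₁)²·e^{−δ|x|₁}` is summable on `ℤ^D`. -/
theorem summable_one_add_l1_sq_mul_exp {δ : ℝ} (hδ : 0 < δ) (D : ℕ) :
    Summable (fun x : Site D => (1 + l1 x) ^ 2 * Real.exp (-δ * l1 x)) := by
  have h1 := (summable_exp_neg_l1 hδ D).mul_left 2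
  have h2 := (B12Sec2to5.majorant_summable hδ D).mul_left 2
  refine Summable.of_nonneg_of_le (fun x => by positivity) (fun x => ?_) (h1.add h2)
  have hl := l1_nonneg x
  have hsq : (1 + l1 x) ^ 2 ≤ 2 + 2 * l1 x ^ 2 := by nlinarith [sq_nonneg (1 - l1 x)]
  have he : 0 ≤ Real.exp (-δ * l1 x) := (Real.exp_pos _).le
  calc (1 + l1 x) ^ 2 * Real.exp (-δ * l1 x) ≤ (2 + 2 * l1 x ^ 2) * Real.exp (-δ * l1 x) := mul_le_mul_of_nonneg_right hsq he
    _ = 2 * Real.exp (-δ * l1 x) + 2 * (l1 x ^ 2 * Real.exp (-δ * l1 x)) := by ring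

/-- [folklore] THE PRODUCT MAJORANT for a weight `|p z| ≤ Kp·(1 + |z|₁)²` and exponentially bounded factors. -/
theorem abs_weight_mul_le {D : ℕ} {p : Site D → ℝ} {Kp : ℝ} (hp : ∀ z, |p z| ≤ Kp * (1 + l1 z) ^ 2) {δ δ' A B a b : ℝ}
    (w u : Site D) (ha : |a| ≤ A * Real.exp (-δ * l1 w)) (hb : |b| ≤ B * Real.exp (-δ' * l1 u)) :
    |p (u - w) * (a * b)| ≤ (Kp * A * ((1 + l1 w) ^ 2 * Real.exp (-δ * l1 w))) * (B * ((1 + l1 u) ^ 2 * Real.exp (-δ' * l1 u))) := by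
  have hKp : 0 ≤ Kp := by
    have h := hp 0
    have hpos : (0 : ℝ) < (1 + l1 (0 : Site D)) ^ 2 := by have := l1_nonneg (0 : Site D); positivity
    nlinarith [abs_nonneg (p 0)]
  have hA : 0 ≤ A := by nlinarith [abs_nonneg a, Real.exp_pos (-δ * l1 w)]
  have hB : 0 ≤ B := by nlinarith [abs_nonneg b, Real.exp_pos (-δ' * l1 u)]
  have hpw : |p (u - w)| ≤ Kp * ((1 + l1 w) ^ 2 * (1 + l1 u) ^ 2) := by
    have h1 := hp (u - w)
    have h2 : l1 (u - w) ≤ l1 w + l1 u := by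
      have := l1_add_le u (-w); rw [l1_neg, ← sub_eq_add_neg] at this; linarith
    have h3 : (1 + l1 (u - w)) ^ 2 ≤ (1 + l1 w) ^ 2 * (1 + l1 u) ^ 2 := by
      have h0 : 0 ≤ l1 (u - w) := l1_nonneg _
      calc (1 + l1 (u - w)) ^ 2 ≤ (1 + (l1 w + l1 u)) ^ 2 := pow_le_pow_left₀ (by positivity) (by linarith) 2
        _ ≤ (1 + l1 w) ^ 2 * (1 + l1 u) ^ 2 := one_add_add_sq_le (l1_nonneg w) (l1_nonneg u)
    exact h1.trans (mul_le_mul_of_nonneg_left h3 hKp)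
  rw [abs_mul, abs_mul]
  calc |p (u - w)| * (|a| * |b|)
      ≤ (Kp * ((1 + l1 w) ^ 2 * (1 + l1 u) ^ 2)) * ((A * Real.exp (-δ * l1 w)) * (B * Real.exp (-δ' * l1 u))) :=
        mul_le_mul hpw (mul_le_mul ha hb (abs_nonneg _) (by positivity)) (by positivity) (by positivity)
    _ = (Kp * A * ((1 + l1 w) ^ 2 * Real.exp (-δ * l1 w))) * (B * ((1 + l1 u) ^ 2 * Real.exp (-δ' * l1 u))) := by ring

variable (N : ℕ) [NeZero N] {Λ Nr : Fin (d + 1) → Site (d + 1) → Site (d + 1) → ℝ} {C C' δ δ' Kp : ℝ} {p : Site (d + 1) → ℝ}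

omit [NeZero N] in
/-- [folklore] **(S2) FROM DECAY**: the level-0 weighted word is absolutely summable on `ℤ^{d+1} × ℤ^{d+1}`. -/
theorem summable_level0_of_decay (hp : ∀ z, |p z| ≤ Kp * (1 + l1 z) ^ 2) (hδ : 0 < δ) (hδ' : 0 < δ') (μ : Fin (d + 1))
    (hΛ : ∀ y u, |Λ μ y u| ≤ C * Real.exp (-δ * l1 ((N : ℤ) • y - u)))
    (hNr : ∀ y u, |Nr μ y u| ≤ C' * Real.exp (-δ' * l1 ((N : ℤ) • y - u))) :
    Summable (Function.uncurry fun (w : Site (d + 1)) (u'' : Site (d + 1)) => p (u'' - w) * (Λ μ 0 w * Nr μ 0 u'')) := by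
  have hΛ0 : ∀ w, |Λ μ 0 w| ≤ C * Real.exp (-δ * l1 w) := fun w => by
    have h := hΛ 0 w; rwa [smul_zero, zero_sub, l1_neg] at h
  have hN0 : ∀ u, |Nr μ 0 u| ≤ C' * Real.exp (-δ' * l1 u) := fun u => by
    have h := hNr 0 u; rwa [smul_zero, zero_sub, l1_neg] at h
  have hf : Summable fun w : Site (d + 1) => Kp * C * ((1 + l1 w) ^ 2 * Real.exp (-δ * l1 w)) :=
    (summable_one_add_l1_sq_mul_exp hδ (d + 1)).mul_left _
  have hg : Summable fun u : Site (d + 1) => C' * ((1 + l1 u) ^ 2 * Real.exp (-δ' * l1 u)) :=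
    (summable_one_add_l1_sq_mul_exp hδ' (d + 1)).mul_left _
  have hKp : 0 ≤ Kp := by
    have h := hp 0
    have hpos : (0 : ℝ) < (1 + l1 (0 : Site (d + 1))) ^ 2 := by have := l1_nonneg (0 : Site (d + 1)); positivity
    nlinarith [abs_nonneg (p 0)]
  have hC : 0 ≤ C := (mul_nonneg_iff_of_pos_right (Real.exp_pos _)).mp ((abs_nonneg _).trans (hΛ0 0))
  have hC' : 0 ≤ C' := (mul_nonneg_iff_of_pos_right (Real.exp_pos _)).mp ((abs_nonneg _).trans (hN0 0))
  have hmaj := hf.mul_of_nonneg hg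
    (fun w => mul_nonneg (mul_nonneg hKp hC) (mul_nonneg (sq_nonneg _) (Real.exp_pos _).le))
    (fun u => mul_nonneg hC' (mul_nonneg (sq_nonneg _) (Real.exp_pos _).le))
  refine Summable.of_norm_bounded hmaj fun q => ?_
  rcases q with ⟨w, u⟩
  rw [Real.norm_eq_abs]
  exact abs_weight_mul_le hp w u (hΛ0 w) (hN0 u)

/-- [folklore] **(S1) FROM DECAY** (shear `u′ = z + N•y`, then a product majorant). -/
theorem summable_word_of_decay (hp : ∀ z, |p z| ≤ Kp * (1 + l1 z) ^ 2) (hδ : 0 < δ) (hδ' : 0 < δ') (μ : Fin (d + 1))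
    (hΛ : ∀ y u, |Λ μ y u| ≤ C * Real.exp (-δ * l1 ((N : ℤ) • y - u)))
    (hNr : ∀ y u, |Nr μ y u| ≤ C' * Real.exp (-δ' * l1 ((N : ℤ) • y - u))) (u : Site (d + 1)) :
    Summable (Function.uncurry fun (y : Site (d + 1)) (u' : Site (d + 1)) => p (u' - u) * (Λ μ y u * Nr μ y u')) := by
  have hKp : 0 ≤ Kp := by
    have h := hp 0
    have hpos : (0 : ℝ) < (1 + l1 (0 : Site (d + 1))) ^ 2 := by have := l1_nonneg (0 : Site (d + 1)); positivity
    nlinarith [abs_nonneg (p 0)]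
  have hC : 0 ≤ C := (mul_nonneg_iff_of_pos_right (Real.exp_pos _)).mp ((abs_nonneg _).trans (hΛ 0 0))
  have hC' : 0 ≤ C' := (mul_nonneg_iff_of_pos_right (Real.exp_pos _)).mp ((abs_nonneg _).trans (hNr 0 0))
  have hΛ' : ∀ y, |Λ μ y u| ≤ C * Real.exp (-δ * l1 (u - (N : ℤ) • y)) := fun y => by
    have h := hΛ y u; rwa [← l1_neg, neg_sub] at h
  have hNr' : ∀ y z, |Nr μ y (z + (N : ℤ) • y)| ≤ C' * Real.exp (-δ' * l1 z) := fun y z => by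
    have h := hNr y (z + (N : ℤ) • y)
    rwa [show (N : ℤ) • y - (z + (N : ℤ) • y) = -z by abel, l1_neg] at h
  have hinj : Function.Injective fun y : Site (d + 1) => u - (N : ℤ) • y := by
    intro y₁ y₂ h
    have h' : (N : ℤ) • y₁ = (N : ℤ) • y₂ := sub_right_injective h
    exact smul_right_injective _ (by exact_mod_cast (NeZero.ne N) : (N : ℤ) ≠ 0) h'
  have hf : Summable fun y : Site (d + 1) => Kp * C * ((1 + l1 (u - (N : ℤ) • y)) ^ 2 * Real.exp (-δ * l1 (u - (N : ℤ) • y))) :=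
    (((summable_one_add_l1_sq_mul_exp hδ (d + 1)).comp_injective hinj).mul_left (Kp * C))
  have hg : Summable fun z : Site (d + 1) => C' * ((1 + l1 z) ^ 2 * Real.exp (-δ' * l1 z)) :=
    (summable_one_add_l1_sq_mul_exp hδ' (d + 1)).mul_left _
  have hmaj := hf.mul_of_nonneg hg
    (fun y => mul_nonneg (mul_nonneg hKp hC) (mul_nonneg (sq_nonneg _) (Real.exp_pos _).le))
    (fun z => mul_nonneg hC' (mul_nonneg (sq_nonneg _) (Real.exp_pos _).le))
  set e : Site (d + 1) × Site (d + 1) ≃ Site (d + 1) × Site (d + 1) :=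
    Equiv.prodShear (Equiv.refl _) (fun y => Equiv.addRight ((N : ℤ) • y)) with he
  refine (e.summable_iff).mp (Summable.of_norm_bounded hmaj fun q => ?_)
  rcases q with ⟨y, z⟩
  rw [Real.norm_eq_abs]
  have h := abs_weight_mul_le hp (u - (N : ℤ) • y) z (hΛ' y) (hNr' y z)
  have harg : z - (u - (N : ℤ) • y) = z + (N : ℤ) • y - u := by abel
  rw [harg] at h
  simpa [he, Equiv.prodShear, Function.uncurry] using h

omit [NeZero N] in
/-- [folklore] MOMENT SUMMABILITY of the level-0 profile from its decay: `Σ_w |w_α w_β Λ μ 0 w| < ∞` (and the lower moments). -/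
theorem summable_moment_of_decay (hδ : 0 < δ) (μ : Fin (d + 1)) (hΛ : ∀ y u, |Λ μ y u| ≤ C * Real.exp (-δ * l1 ((N : ℤ) • y - u)))
    (q : Site (d + 1) → ℝ) (hq : ∀ w, |q w| ≤ (1 + l1 w) ^ 2) :
    Summable fun w : Site (d + 1) => q w * Λ μ 0 w := by
  have hΛ0 : ∀ w, |Λ μ 0 w| ≤ C * Real.exp (-δ * l1 w) := fun w => by
    have h := hΛ 0 w; rwa [smul_zero, zero_sub, l1_neg] at h
  refine Summable.of_norm_bounded ((summable_one_add_l1_sq_mul_exp hδ (d + 1)).mul_left C) fun w => ?_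
  rw [Real.norm_eq_abs, abs_mul]
  have hC : 0 ≤ C := (mul_nonneg_iff_of_pos_right (Real.exp_pos _)).mp ((abs_nonneg _).trans (hΛ0 w))
  calc |q w| * |Λ μ 0 w| ≤ (1 + l1 w) ^ 2 * (C * Real.exp (-δ * l1 w)) := mul_le_mul (hq w) (hΛ0 w) (abs_nonneg _) (by positivity)
    _ = C * ((1 + l1 w) ^ 2 * Real.exp (-δ * l1 w)) := by ring

/-- [folklore] `|1| ≤ (1 + |z|₁)²`, `|z_γ| ≤ (1 + |z|₁)²`, `|z_α z_β| ≤ (1 + |z|₁)²` — the three weights used. -/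
theorem abs_weights_le {D : ℕ} (z : Site D) (α β γ : Fin D) :
    |(1 : ℝ)| ≤ 1 * (1 + l1 z) ^ 2 ∧ |((z γ : ℤ) : ℝ)| ≤ (1 + l1 z) ^ 2 ∧
      |((z α : ℤ) : ℝ) * ((z β : ℤ) : ℝ)| ≤ 1 * (1 + l1 z) ^ 2 := by
  have hl := l1_nonneg z
  have hγ := abs_coord_le_l1 z γ; have hα := abs_coord_le_l1 z α; have hβ := abs_coord_le_l1 z β
  refine ⟨?_, ?_, ?_⟩
  · rw [abs_one]; nlinarith
  · nlinarith
  · rw [abs_mul, one_mul]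
    calc |((z α : ℤ) : ℝ)| * |((z β : ℤ) : ℝ)| ≤ l1 z * l1 z := mul_le_mul hα hβ (abs_nonneg _) hl
      _ ≤ (1 + l1 z) ^ 2 := by nlinarith

/-- [folklore] **`M₀ = 0`, DECAY FORM** (owner's statement). -/
theorem blockAvg_M0_eq_zero_of_decay
    (hcovΛ : ∀ μ y t u, Λ μ (y + t) (u + (N : ℤ) • t) = Λ μ y u)
    (hcovN : ∀ μ y t u', Nr μ (y + t) (u' + (N : ℤ) • t) = Nr μ y u')
    (hδ : 0 < δ) (hδ' : 0 < δ')
    (hΛ : ∀ μ y u, |Λ μ y u| ≤ C * Real.exp (-δ * l1 ((N : ℤ) • y - u)))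
    (hNr : ∀ μ y u, |Nr μ y u| ≤ C' * Real.exp (-δ' * l1 ((N : ℤ) • y - u)))
    (h0 : ∀ μ : Fin (d + 1), ∑' u, Λ μ 0 u = 0) :
    ((N : ℝ) ^ (d + 1))⁻¹ * ∑ b ∈ box (d + 1) N, ∑' u', (∑ μ, ∑' y, Λ μ y (toSite b) * Nr μ y u') = 0 := by
  have hp : ∀ z : Site (d + 1), |(fun _ : Site (d + 1) => (1 : ℝ)) z| ≤ 1 * (1 + l1 z) ^ 2 := fun z => (abs_weights_le z 0 0 0).1
  have hS1 := fun μ u => summable_word_of_decay N (p := fun _ => (1 : ℝ)) hp hδ hδ' μ (hΛ μ) (hNr μ) u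
  have hS2 := fun μ => summable_level0_of_decay N (p := fun _ => (1 : ℝ)) hp hδ hδ' μ (hΛ μ) (hNr μ)
  simp only [one_mul] at hS1 hS2
  exact blockAvg_M0_eq_zero N Λ Nr hcovΛ hcovN hS1 hS2 h0

/-- [folklore] **`M₂` FACTORISATION, DECAY FORM** (owner's statement). -/
theorem blockAvg_M2_eq_of_decay (α β : Fin (d + 1))
    (hcovΛ : ∀ μ y t u, Λ μ (y + t) (u + (N : ℤ) • t) = Λ μ y u)
    (hcovN : ∀ μ y t u', Nr μ (y + t) (u' + (N : ℤ) • t) = Nr μ y u')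
    (hδ : 0 < δ) (hδ' : 0 < δ')
    (hΛ : ∀ μ y u, |Λ μ y u| ≤ C * Real.exp (-δ * l1 ((N : ℤ) • y - u)))
    (hNr : ∀ μ y u, |Nr μ y u| ≤ C' * Real.exp (-δ' * l1 ((N : ℤ) • y - u)))
    (h0 : ∀ μ : Fin (d + 1), ∑' u, Λ μ 0 u = 0) (h1 : ∀ μ γ : Fin (d + 1), ∑' u : Site (d + 1), ((u γ : ℤ) : ℝ) * Λ μ 0 u = 0) :
    ((N : ℝ) ^ (d + 1))⁻¹ * ∑ b ∈ box (d + 1) N, ∑' u', ((((u' - toSite b) α : ℤ) : ℝ) * (((u' - toSite b) β : ℤ) : ℝ))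
        * (∑ μ, ∑' y, Λ μ y (toSite b) * Nr μ y u')
      = ((N : ℝ) ^ (d + 1))⁻¹ * ∑ μ, (∑' w : Site (d + 1), ((w α : ℤ) : ℝ) * ((w β : ℤ) : ℝ) * Λ μ 0 w) * (∑' u', Nr μ 0 u') := by
  have hp : ∀ z : Site (d + 1), |(fun z : Site (d + 1) => ((z α : ℤ) : ℝ) * ((z β : ℤ) : ℝ)) z| ≤ 1 * (1 + l1 z) ^ 2 :=
    fun z => (abs_weights_le z α β 0).2.2
  have hS1 := fun μ u => summable_word_of_decay N (p := fun z : Site (d + 1) => ((z α : ℤ) : ℝ) * ((z β : ℤ) : ℝ))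
    hp hδ hδ' μ (hΛ μ) (hNr μ) u
  have hS2 := fun μ => summable_level0_of_decay N (p := fun z : Site (d + 1) => ((z α : ℤ) : ℝ) * ((z β : ℤ) : ℝ))
    hp hδ hδ' μ (hΛ μ) (hNr μ)
  have hΛ0 : ∀ μ : Fin (d + 1), Summable (Λ μ 0) := fun μ => by
    have h := summable_moment_of_decay N hδ μ (hΛ μ) (fun _ => 1) (fun w => by
      rw [abs_one]; nlinarith [l1_nonneg w])
    simpa only [one_mul] using h
  have hΛ1 : ∀ μ γ : Fin (d + 1), Summable fun w : Site (d + 1) => ((w γ : ℤ) : ℝ) * Λ μ 0 w := fun μ γ =>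
    summable_moment_of_decay N hδ μ (hΛ μ) _ (fun w => (abs_weights_le w α β γ).2.1)
  have hΛ2 : ∀ μ : Fin (d + 1), Summable fun w : Site (d + 1) => ((w α : ℤ) : ℝ) * ((w β : ℤ) : ℝ) * Λ μ 0 w := fun μ =>
    summable_moment_of_decay N hδ μ (hΛ μ) _ (fun w => by
      have := (abs_weights_le w α β 0).2.2; rwa [one_mul] at this)
  exact blockAvg_M2_eq N Λ Nr α β hcovΛ hcovN hS1 hS2 hΛ0 hΛ1 hΛ2 h0 h1

end Decay

end Summit.QuantumFields.BalabanUV.Beta.D1BFx.LamFactor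

end
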